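import Summits.Ventures.YMGap.FlowData.TubeVacuumSector
import HarnessLib

/-!
# Venture YMGap, track Y3 FLOW-DATA — every non-trivial centre flux COSTS energy on a finite tube:
# `‖T ∘ P_e‖ < ‖T‖` and `E_e > 0` for `e ≠ 0` (Jentzsch gap; theorems only)

HONEST FRAMING: venture file of the cell `pub-ymgap` (QuantumFields programme), track Y3; companion THEOREMS for
`FlowData/TorelonEnergy.lean` (lead R237 (c)).  By the spectral gap of a compact self-adjoint positivity-improving
operator (tree `IsPositivityImproving.exists_spectralGap`) and the twist-invariance of the vacuum
(`TubeVacuumSector`), every flux sector `e ≠ 0` is orthogonal to the ground state, so its top lies strictly below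
`‖T‖`: `tubeSectorNorm_lt_norm`, and the flux energy is STRICTLY POSITIVE whenever the sector is not annihilated,
`tubeFluxEnergy_pos` — in particular the torelon energy `E₁ > 0` on every finite tube (`su2TorelonEnergy_pos`).  This is
a FINITE-VOLUME statement (a gap of a compact operator), not confinement, not a string tension, nothing about
`L → ∞` or the continuum.

References: M. Reed, B. Simon IV (1978) Thm. XIII.43–44 [cite: ReedSimonIV1978, §XIII.12]; G. 't Hooft, Nucl. Phys.
B 153 (1979) 141 [cite: tHooft1979Flux].
-/

noncomputable section

open scoped BigOperators ENNReal
open MeasureTheory Filter Function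
open Literature.MathematicalPhysics.QuantumFieldTheory Literature.Analysis.OperatorTheory

namespace Summit.Ventures.YMGap.FlowData

section Gap

variable {G : Type*} [Group G] [TopologicalSpace G] [IsTopologicalGroup G] [CompactSpace G]
  [MeasurableSpace G] [BorelSpace G] [SecondCountableTopology G] {n : ℕ} (ρ : G →* Matrix (Fin n) (Fin n) ℂ)
  (J : ℝ) {k L : ℕ} [NeZero L]

/-- **Non-trivial flux sectors lie strictly below the vacuum**: `‖T ∘ P_e‖ < ‖T‖` for `e ≠ 0`, central involution
`z`, continuous unitary `ρ` (the range of `P_e` is orthogonal to the twist-invariant ground state, on whose orthogonal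
complement `T` has norm `θ < ‖T‖` by Jentzsch's gap). [cite: ReedSimonIV1978, §XIII.12] -/
theorem tubeSectorNorm_lt_norm (hρ : Continuous ρ) (hρu : ∀ g, ρ g ∈ Matrix.unitaryGroup (Fin n) ℂ) {z : G}
    (hz : z ∈ Subgroup.center G) (hz2 : z * z = 1) {e : Fin k → ZMod 2} (he : e ≠ 0) :
    tubeSectorNorm ρ z J k L e < ‖tubeTransferOperator ρ J k L‖ := by
  set T := tubeTransferOperator ρ J k L with hT
  obtain ⟨φ₀, h1, hpos, heig, hsimple, θ, hθ0, hθlt, hgap⟩ :=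
    (isPositivityImproving_tubeTransferOperator J k L hρ).exists_spectralGap
      (isSelfAdjoint_tubeTransferOperator J k L hρ hρu) (isCompactOperator_tubeTransferOperator J k L hρ)
      (tubeTransferOperator_ne_zero J k L hρ)
  -- the vacuum of `exists_vacuum` is a multiple of `φ₀`, so `φ₀` itself is twist invariant up to that scalar;
  -- we only need `P_e φ₀ = 0`, which follows from `P_e ψ₀ = 0` for the twist-invariant unit vacuum `ψ₀ = c φ₀`.
  obtain ⟨ψ₀, hψ1, -, hψeig, -, hψinv⟩ := exists_vacuum ρ J hρ hρu hz (k := k) (L := L)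
  have hψφ : ψ₀ = (@inner ℝ _ _ φ₀ ψ₀) • φ₀ := hsimple ψ₀ hψeig
  have hc : @inner ℝ _ _ φ₀ ψ₀ ≠ 0 := by
    intro h0
    rw [h0, zero_smul] at hψφ
    rw [hψφ, norm_zero] at hψ1
    exact zero_ne_one hψ1
  have hPψ : tubeFluxProjection z k L e ψ₀ = 0 := by
    rw [tubeFluxProjection_apply_of_invariant z hψinv, if_neg he]
  have hPφ : tubeFluxProjection z k L e φ₀ = 0 := by
    have h := hPψ
    rw [hψφ, map_smul, smul_eq_zero] at h
    exact h.resolve_left hc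
  -- every `P_e ψ` is orthogonal to `φ₀` (self-adjointness of `P_e`)
  have hsa := isSelfAdjoint_tubeFluxProjection (k := k) (L := L) z hz2 e
  have horth : ∀ ψ, @inner ℝ _ _ φ₀ (tubeFluxProjection z k L e ψ) = 0 := by
    intro ψ
    have h := (ContinuousLinearMap.isSelfAdjoint_iff_isSymmetric.1 hsa) φ₀ ψ
    change @inner ℝ _ _ (tubeFluxProjection z k L e φ₀) ψ = @inner ℝ _ _ φ₀ (tubeFluxProjection z k L e ψ) at h
    rw [← h, hPφ, inner_zero_left]
  -- hence `‖T P_e ψ‖ ≤ θ ‖P_e ψ‖ ≤ θ ‖ψ‖`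
  have hbound : ‖T.comp (tubeFluxProjection z k L e)‖ ≤ θ := by
    refine ContinuousLinearMap.opNorm_le_bound _ hθ0 fun ψ => ?_
    rw [ContinuousLinearMap.comp_apply]
    calc ‖T (tubeFluxProjection z k L e ψ)‖ ≤ θ * ‖tubeFluxProjection z k L e ψ‖ := hgap _ (horth ψ)
      _ ≤ θ * (‖tubeFluxProjection z k L e‖ * ‖ψ‖) :=
          mul_le_mul_of_nonneg_left ((tubeFluxProjection z k L e).le_opNorm ψ) hθ0
      _ ≤ θ * (1 * ‖ψ‖) := mul_le_mul_of_nonneg_left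
          (mul_le_mul_of_nonneg_right (norm_tubeFluxProjection_le_one z k L e) (norm_nonneg _)) hθ0
      _ = θ * ‖ψ‖ := by rw [one_mul]
  exact lt_of_le_of_lt hbound hθlt

/-- **Every non-trivial flux costs energy on a finite tube: `E_e > 0`** for `e ≠ 0`, whenever the sector is not
annihilated (`0 < ‖T ∘ P_e‖`); central involution `z`, continuous unitary `ρ`. A finite-volume spectral statement,
not confinement. [cite: ReedSimonIV1978, §XIII.12] -/
theorem tubeFluxEnergy_pos (hρ : Continuous ρ) (hρu : ∀ g, ρ g ∈ Matrix.unitaryGroup (Fin n) ℂ) {z : G}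
    (hz : z ∈ Subgroup.center G) (hz2 : z * z = 1) {e : Fin k → ZMod 2} (he : e ≠ 0)
    (hpos : 0 < tubeSectorNorm ρ z J k L e) : 0 < tubeFluxEnergy ρ z J k L e := by
  unfold tubeFluxEnergy fluxEnergy
  exact sub_pos.2 (Real.log_lt_log hpos (tubeSectorNorm_lt_norm ρ J hρ hρu hz hz2 he))

/-- A unit flux label is non-trivial: `ê_μ ≠ 0` in `ℤ₂^k`. [folklore] -/
theorem single_one_ne_zero (μ : Fin k) : (Pi.single μ 1 : Fin k → ZMod 2) ≠ 0 := by
  intro h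
  have := congrFun h μ
  rw [Pi.single_eq_same, Pi.zero_apply] at this
  exact one_ne_zero this

/-- **The cell's torelon energy is strictly positive on every finite tube**: `0 < su2TorelonEnergy β k L μ` for
every real `β`, whenever the flux sector along `μ` is not annihilated (`0 < ‖T ∘ P_{ê_μ}‖`, automatic in every
certified row). Finite volume only. [folklore] -/
theorem su2TorelonEnergy_pos (β : ℝ) (k L : ℕ) [NeZero L] (μ : Fin k)
    (hpos : 0 < tubeSectorNorm (Literature.MathematicalPhysics.QuantumLattice.fundamentalRep (Fin 2)) su2MinusOne
      (β / 2) k L (Pi.single μ 1)) :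
    0 < su2TorelonEnergy β k L μ := by
  haveI : SecondCountableTopology (Matrix.specialUnitaryGroup (Fin 2) ℂ) :=
    Literature.MathematicalPhysics.QuantumLattice.secondCountableTopology_su2
  exact tubeFluxEnergy_pos (Literature.MathematicalPhysics.QuantumLattice.fundamentalRep (Fin 2)) (β / 2)
    (Literature.MathematicalPhysics.QuantumLattice.continuous_fundamentalRep (Fin 2))
    Literature.MathematicalPhysics.QuantumLattice.fundamentalRep_mem_unitaryGroup su2MinusOne_mem_center
    su2MinusOne_mul_self (single_one_ne_zero μ) hpos

end Gap

end Summit.Ventures.YMGap.FlowData
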